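import Summits.Ventures.PackingBounds.Energy.TenPointCkFive
import Summits.Ventures.PackingBounds.Configurations.OrthogonalPentagons
import HarnessLib

/-!
# Ten points on `S³`, potential `(1+⟪x,y⟫)^5`: the two-sided statement (two orthogonal regular pentagons are optimal)

Framing: lottery ticket; floor = certified bounds/negative ranges. Venture `PackingBounds`, cell
`pub-packcert`, energy family E3PT (pub-packcert-energy gen 14; n = 4 kernel route = KERNEL-D6 data route + `threePointF 4`).

Combines the kernel-checked sharp three-point bound `TenPointCkFive.ck5_ten_points`
(`Σ_{x ≠ y} (1+⟪x,y⟫)^5 ≥ 1015/8` for every ten unit vectors of `ℝ⁴`) with the explicit configuration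
`Config.OrthogonalPentagons.exists_config` (two regular pentagons in orthogonal planes of `ℝ⁴`: per point, inner products `cos 72° = (√5-1)/4`
and `cos 144° = -(√5+1)/4` twice each inside its pentagon and `0` five times across): the minimum is exactly
`1015/8 = 10·(2(1+cos 72°)^5 + 2(1+cos 144°)^5 + 5)` (ordered pairs) — the case `k = 5` of Cohn–Woo's numerical observation
(J. AMS 2012, §5.3: the three-point bound is sharp for two orthogonal pentagons, 3 ≤ k ≤ 6) as a theorem.
-/

noncomputable section

open Finset
open scoped RealInnerProductSpace

namespace Summit.Ventures.PackingBounds.Energy.TenPointCkFive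

open Summit.Ventures.PackingBounds.Config

/-- Two orthogonal regular pentagons attain `1015/8`: ten unit vectors of `ℝ⁴` with `Σ_{x≠y} (1+⟪x,y⟫)^5 = 1015/8`. -/
theorem pentagons_ck5_energy : ∃ C : Finset (EuclideanSpace ℝ (Fin 4)), C.card = 10 ∧ (∀ x ∈ C, ‖x‖ = 1) ∧
    ∑ x ∈ C, ∑ y ∈ C.erase x, (1 + inner ℝ x y) ^ 5 = ((1015 : ℝ)/8) := by
  obtain ⟨C, hc, hn, _, he⟩ := OrthogonalPentagons.exists_config
  refine ⟨C, hc, hn, ?_⟩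
  rw [he (fun t : ℝ => (1 + t) ^ 5)]
  have hX : Real.sqrt 5 ^ 2 = 5 := Real.sq_sqrt (by norm_num)
  have h4 : Real.sqrt 5 ^ 4 = 25 := by rw [show Real.sqrt 5 ^ 4 = (Real.sqrt 5 ^ 2) ^ 2 by ring, hX]; norm_num
  have h6 : Real.sqrt 5 ^ 6 = 125 := by rw [show Real.sqrt 5 ^ 6 = (Real.sqrt 5 ^ 2) ^ 3 by ring, hX]; norm_num
  linear_combination (((675 : ℝ)/64)) * hX + (((75 : ℝ)/128)) * h4 + ((0 : ℝ)) * h6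

/-- **Ten points on `S³`, potential `(1+⟪x,y⟫)^5`, two-sided:** the least value of `Σ_{x ≠ y} (1+⟪x,y⟫)^5`
over ten unit vectors of `ℝ⁴` is `1015/8`, attained by two orthogonal regular pentagons. -/
theorem ck5_ten_points_isLeast :
    IsLeast {E : ℝ | ∃ C : Finset (EuclideanSpace ℝ (Fin 4)), C.card = 10 ∧ (∀ x ∈ C, ‖x‖ = 1) ∧
      E = ∑ x ∈ C, ∑ y ∈ C.erase x, (1 + inner ℝ x y) ^ 5} (((1015 : ℝ)/8)) := by
  obtain ⟨C0, hc0, hn0, he0⟩ := pentagons_ck5_energy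
  refine ⟨⟨C0, hc0, hn0, he0.symm⟩, ?_⟩
  rintro E ⟨C, h10, hC, rfl⟩
  exact ck5_ten_points C hC h10

end Summit.Ventures.PackingBounds.Energy.TenPointCkFive
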